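import Summits.AnomalousDissipation.AnomalousDissipation.Theorems.SolenoidalFractalHomogenisationLagrangianStepSidebandBlockMatrix
import Summits.AnomalousDissipation.AnomalousDissipation.Theorems.SolenoidalFractalHomogenisationLagrangianStepSidebandResponseTransversal
import HarnessLib

/-!
# K1L_D `stub_D1_residueTail` (registry v17, stmt-AnomalousDissipation-27980) — lane A4 brick P: THE PICKUP BOUND of a slot's feedback functional and the
# transversality of the own-slot semigroup (helper; `--supports stmt-AnomalousDissipation-27980`)

Summits-side helper file of route `SolenoidalFractalHomogenisation` (prover seat `ad-sawtooth-k1loc-p1` g13; lane A of the tail certificate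
`Lines/onelevel-D1-tail-cert.md`, the factor `Apick`/`√PpSq` of every case).  Everything proved; no definitions, no named facts, no sorry.
* `norm_slotAmp`, `two_pi_mul_norm_slotAmp` — `‖αⱼ‖ = 1/(2·2π|mⱼ|)`, `2π‖αⱼ‖ = 1/(2|mⱼ|)`;
* **`norm_inner_pickup_le`** — for transversal amplitudes `a = P_m a`, `b = P_m b` and any `w ∈ ℂ³`:
  `‖⟪w, (2πi envⱼ(t)) • (αⱼ • a + ᾱⱼ • b)⟫‖ ≤ (1/(2|mⱼ|)) · ‖P_{mⱼ} w‖ · (‖a‖ + ‖b‖)` — the pickup functional of slot `j` only sees the projection of the test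
  vector transverse to `mⱼ` (hence the factor `√PpSq_j(p)` of the certificate) and is bounded by `1/(2|mⱼ|)` per unit amplitude (`|env| ≤ 1`);
* **`norm_inner_feedback_le`** — the same for `feedbackⱼ(t) y` with `y_{±mⱼ}` transversal: `‖⟪w, feedbackⱼ(t) y⟫‖ ≤ (1/(2|mⱼ|))·‖P_{mⱼ} w‖·(‖y_{−mⱼ}‖ + ‖y_{mⱼ}‖)`;
* `projPerp_commute_regBlock`, `projPerp_mul_exp_regBlock_mul_projPerp`, **`transversalProj_exp_blockGen_transversalProj`** — `P̂` commutes with `B̂ = P̂Σ̂P̂ + m̂m̂ᵀ`,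
  hence with `exp(c•B̂)`; so the own-slot semigroup preserves transversality: `P_m (exp(u•B↾ℝ)(P_m z)) = exp(u•B↾ℝ)(P_m z)` (`𝔸 = ν•S`).
NOT a proof of any registered stub, of the crux, or of anomalous dissipation; rung leaf F-D1 infrastructure.
-/

set_option linter.dupNamespace false

noncomputable section

namespace Summit.AnomalousDissipation.AnomalousDissipation.Theorems.SolenoidalFractalHomogenisation.LagrangianStep.Sideband

open Set MeasureTheory Complex Matrix
open scoped InnerProductSpace
open Literature.Analysis Literature.Analysis.FunctionSpaces Literature.Analysis.FunctionSpaces.Torus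
open Literature.Analysis.FluidPDE Literature.Analysis.FluidPDE.Torus Literature.Analysis.FluidPDE.LatticeShear

variable {k₀ : ℕ}

/-! ## §1 The size of the slot amplitude -/

/-- `‖αⱼ‖ = 1/(2·(2π|mⱼ|))`. [cite: MeshalkinSinai1961, pp. 1700–1705] -/
theorem norm_slotAmp (W₁ : LatticeWord k₀) (j : Fin k₀) : ‖slotAmp W₁ j‖ = 1 / (2 * (2 * Real.pi * ‖latticeVec (W₁.phase j).m‖)) := by
  have h2 := normSq_slotAmp W₁ j
  rw [Complex.normSq_eq_norm_sq] at h2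
  have hm : 0 < ‖latticeVec (W₁.phase j).m‖ := norm_latticeVec_pos (W₁.phase j)
  have hπ := Real.pi_pos
  have hpos : 0 < 1 / (2 * (2 * Real.pi * ‖latticeVec (W₁.phase j).m‖)) := by positivity
  have hsq : ‖slotAmp W₁ j‖ ^ 2 = (1 / (2 * (2 * Real.pi * ‖latticeVec (W₁.phase j).m‖))) ^ 2 := by
    rw [h2]; field_simp; ring
  exact (pow_left_inj₀ (norm_nonneg _) hpos.le two_ne_zero).1 hsq

/-- `2π‖αⱼ‖ = 1/(2|mⱼ|)`. [cite: MeshalkinSinai1961, pp. 1700–1705] -/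
theorem two_pi_mul_norm_slotAmp (W₁ : LatticeWord k₀) (j : Fin k₀) : 2 * Real.pi * ‖slotAmp W₁ j‖ = 1 / (2 * ‖latticeVec (W₁.phase j).m‖) := by
  rw [norm_slotAmp]
  have hm : 0 < ‖latticeVec (W₁.phase j).m‖ := norm_latticeVec_pos (W₁.phase j)
  have hπ := Real.pi_pos
  field_simp

/-! ## §2 The pickup bound -/

/-- Pairing with a transversal amplitude only sees the transverse part of the test vector: `‖⟪w, a⟫‖ ≤ ‖P_m w‖·‖a‖` if `P_m a = a`. [cite: Temam1984, Ch. III §1.1] -/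
theorem norm_inner_le_of_transversal (m : Fin 3 → ℤ) (w : EuclideanSpace ℂ (Fin 3)) {a : EuclideanSpace ℂ (Fin 3)} (ha : transversalProj m a = a) :
    ‖⟪w, a⟫_ℂ‖ ≤ ‖transversalProj m w‖ * ‖a‖ := by
  rw [← ha, ← inner_transversalProj_comm, ha]
  exact norm_inner_le_norm _ _

/-- **THE PICKUP BOUND.**  For transversal amplitudes `a = P_m a`, `b = P_m b` (at `−mⱼ` and `mⱼ`) and any test vector `w`:
`‖⟪w, (2πi envⱼ(t)) • (αⱼ • a + ᾱⱼ • b)⟫‖ ≤ (1/(2|mⱼ|))·‖P_{mⱼ} w‖·(‖a‖ + ‖b‖)`. [cite: MajdaKramer1999, §2.2.1.3 (55)] [cite: MeshalkinSinai1961, pp. 1700–1705] -/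
theorem norm_inner_pickup_le (W₁ : LatticeWord k₀) (j : Fin k₀) (t : ℝ) (w : EuclideanSpace ℂ (Fin 3)) {a b : EuclideanSpace ℂ (Fin 3)}
    (ha : transversalProj (W₁.phase j).m a = a) (hb : transversalProj (W₁.phase j).m b = b) :
    ‖⟪w, (2 * Real.pi * Complex.I * ((slotEnvelope W₁ j t : ℝ) : ℂ)) • (slotAmp W₁ j • a + starRingEnd ℂ (slotAmp W₁ j) • b)⟫_ℂ‖ ≤
      1 / (2 * ‖latticeVec (W₁.phase j).m‖) * ‖transversalProj (W₁.phase j).m w‖ * (‖a‖ + ‖b‖) := by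
  have henv := slotEnvelope_mem_Icc W₁ j t
  have hα := two_pi_mul_norm_slotAmp W₁ j
  rw [inner_smul_right, inner_add_right, inner_smul_right, inner_smul_right, norm_mul]
  have h1 : ‖2 * (Real.pi : ℂ) * Complex.I * ((slotEnvelope W₁ j t : ℝ) : ℂ)‖ ≤ 2 * Real.pi := by
    rw [norm_mul, norm_mul, norm_mul, Complex.norm_I, mul_one, Complex.norm_real, Complex.norm_two, Complex.norm_real,
      Real.norm_of_nonneg Real.pi_pos.le, Real.norm_of_nonneg henv.1]
    nlinarith [henv.2, Real.pi_pos]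
  have h2 : ‖slotAmp W₁ j * ⟪w, a⟫_ℂ + starRingEnd ℂ (slotAmp W₁ j) * ⟪w, b⟫_ℂ‖ ≤ ‖slotAmp W₁ j‖ * (‖transversalProj (W₁.phase j).m w‖ * (‖a‖ + ‖b‖)) := by
    refine (norm_add_le _ _).trans ?_
    rw [norm_mul, norm_mul, Complex.norm_conj, mul_add, mul_add]
    exact add_le_add (mul_le_mul_of_nonneg_left (norm_inner_le_of_transversal _ w ha) (norm_nonneg _))
      (mul_le_mul_of_nonneg_left (norm_inner_le_of_transversal _ w hb) (norm_nonneg _))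
  have h0 : 0 ≤ ‖transversalProj (W₁.phase j).m w‖ * (‖a‖ + ‖b‖) := by positivity
  calc ‖2 * (Real.pi : ℂ) * Complex.I * ((slotEnvelope W₁ j t : ℝ) : ℂ)‖ * ‖slotAmp W₁ j * ⟪w, a⟫_ℂ + starRingEnd ℂ (slotAmp W₁ j) * ⟪w, b⟫_ℂ‖
      ≤ (2 * Real.pi) * (‖slotAmp W₁ j‖ * (‖transversalProj (W₁.phase j).m w‖ * (‖a‖ + ‖b‖))) :=
        mul_le_mul h1 h2 (norm_nonneg _) (by positivity)
    _ = 1 / (2 * ‖latticeVec (W₁.phase j).m‖) * ‖transversalProj (W₁.phase j).m w‖ * (‖a‖ + ‖b‖) := by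
        rw [← hα]; ring

/-- **THE PICKUP BOUND FOR THE FEEDBACK FUNCTIONAL**: if the fibres `y_{±mⱼ}` are transversal, then
`‖⟪w, feedbackⱼ(t) y⟫‖ ≤ (1/(2|mⱼ|))·‖P_{mⱼ} w‖·(‖y_{−mⱼ}‖ + ‖y_{mⱼ}‖)`. [cite: MajdaKramer1999, §2.2.1.3 (55)] -/
theorem norm_inner_feedback_le (W₁ : LatticeWord k₀) (R : ℕ) (j : Fin k₀) (t : ℝ) (w : EuclideanSpace ℂ (Fin 3)) {y : Space R}
    (ha : transversalProj (W₁.phase j).m (coordL R (-(W₁.phase j).m) y) = coordL R (-(W₁.phase j).m) y)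
    (hb : transversalProj (W₁.phase j).m (coordL R (W₁.phase j).m y) = coordL R (W₁.phase j).m y) :
    ‖⟪w, feedback W₁ R j t y⟫_ℂ‖ ≤
      1 / (2 * ‖latticeVec (W₁.phase j).m‖) * ‖transversalProj (W₁.phase j).m w‖ * (‖coordL R (-(W₁.phase j).m) y‖ + ‖coordL R (W₁.phase j).m y‖) := by
  rw [feedback_apply]
  exact norm_inner_pickup_le W₁ j t w ha hb

/-- The fibres of a periodic response are transversal, read through `coordL` at `±mⱼ` (`P_{−m} = P_m`). [cite: Temam1984, Ch. III §1.1] -/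
theorem transversalProj_coordL_response (W₁ : LatticeWord k₀) {𝔸 : Torus.Visc4 (Fin 3)} {lo' hi' : ℝ} (h𝔸 : Torus.NearIso 𝔸 lo' hi')
    (hlo' : 0 < lo') {γ₁ : ℝ} (hγ₁ : 0 < γ₁) {R : ℕ} (j : Fin k₀) {t : ℝ} (ht : t ∈ Icc 0 W₁.period) (v : EuclideanSpace ℂ (Fin 3))
    (m w : Fin 3 → ℤ) (hw : w = m ∨ w = -m) :
    transversalProj m (coordL R w (response W₁ 𝔸 γ₁ R j t v)) = coordL R w (response W₁ 𝔸 γ₁ R j t v) := by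
  by_cases hwb : w ∈ box R
  · rw [coordL_apply_of_mem hwb]
    have h := transversalProj_response_apply W₁ h𝔸 hlo' hγ₁ j ht v ⟨w, hwb⟩
    rcases hw with rfl | rfl
    · exact h
    · rw [← transversalProj_neg_wave]; exact h
  · rw [coordL_apply_of_not_mem hwb, map_zero]

/-! ## §3 The own-slot semigroup preserves transversality -/

/-- `P̂` commutes with the regularised block `B̂ = P̂Σ̂P̂ + m̂m̂ᵀ` (unit `m̂`). [folklore] -/
theorem projPerp_commute_regBlock (S : Torus.Visc4 (Fin 3)) {n : Fin 3 → ℝ} (hn : ∑ a, n a ^ 2 = 1) : Commute (projPerp n) (regBlock S n) := by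
  rw [Commute, SemiconjBy, regBlock, Matrix.mul_add, Matrix.add_mul, ← Matrix.mul_assoc, ← Matrix.mul_assoc, projPerp_mul_projPerp hn,
    Matrix.mul_assoc (projPerp n * sigMat S n), projPerp_mul_projPerp hn, projPerp_mul_vecMulVec hn, vecMulVec_mul_projPerp hn]

/-- `P̂ · exp(c•B̂) · P̂ = exp(c•B̂) · P̂`. [folklore] -/
theorem projPerp_mul_exp_regBlock_mul_projPerp (S : Torus.Visc4 (Fin 3)) {n : Fin 3 → ℝ} (hn : ∑ a, n a ^ 2 = 1) (c : ℝ) :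
    projPerp n * NormedSpace.exp (c • regBlock S n) * projPerp n = NormedSpace.exp (c • regBlock S n) * projPerp n := by
  open scoped Matrix.Norms.Operator in
  have h : Commute (projPerp n) (NormedSpace.exp (c • regBlock S n)) := ((projPerp_commute_regBlock S hn).smul_right c).exp_right
  rw [h.eq, Matrix.mul_assoc, projPerp_mul_projPerp hn]

/-- **The own-slot semigroup preserves transversality**: `P_m (exp(u•B↾ℝ)(P_m z)) = exp(u•B↾ℝ)(P_m z)` for `B = blockGen (ν•S) γ₁ m`, `m` the wave vector
of a lattice phase. [cite: MajdaKramer1999, §2.2.1.3 (cell problem (49))] -/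
theorem transversalProj_exp_blockGen_transversalProj (S : Torus.Visc4 (Fin 3)) (ν γ₁ : ℝ) (P : LatticePhase) (u : ℝ) (z : EuclideanSpace ℂ (Fin 3)) :
    transversalProj P.m (NormedSpace.exp (u • (blockGen (ν • S) γ₁ P.m).restrictScalars ℝ) (transversalProj P.m z)) =
      NormedSpace.exp (u • (blockGen (ν • S) γ₁ P.m).restrictScalars ℝ) (transversalProj P.m z) := by
  rw [exp_blockGen_transversalProj, transversalProj_eq_cmat, ← mul_apply_eq_comp, ← map_mul, ← map_ofReal_mul, ← Matrix.mul_assoc,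
    projPerp_mul_exp_regBlock_mul_projPerp S (sum_mhat_sq P)]

end Summit.AnomalousDissipation.AnomalousDissipation.Theorems.SolenoidalFractalHomogenisation.LagrangianStep.Sideband

end
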